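import Literature.AlgebraicGeometry.Motives.ThickeningTower
import Literature.AlgebraicGeometry.Motives.AbelianVarietyProofs
import Mathlib.AlgebraicGeometry.Morphisms.Smooth
import Mathlib.RingTheory.Smooth.Basic
import Mathlib.RingTheory.Derivation.ToSquareZero
import HarnessLib

/-!
# Smooth schemes: morphisms from local points lift along nilpotent thickenings
# (the infinitesimal lifting property, packaged for `Spec(𝒪_{T,t}/𝔪^{n+1})`)

Layer `Literature/AlgebraicGeometry/Motives`, namespace `Literature.AlgebraicGeometry.Motives`.  THEOREMS ONLY
(no definition, no named fact, no instance, no socket).  Generic capital of the cell `hodgecm-mathlib`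
(M13 programme, node N3 leaf (3b): «`Â → Spec ℂ` smooth ⇒ the `Â`-coordinate of an infinitesimal graph point
lifts along a small extension», [MumfordAV1970] §13, proof of the Theorem p. 125: «since `X̂` is non-singular,
`g` lifts to `R'`», and p. 126: «the set of all liftings is a principal homogeneous space»).

* `exists_lift_of_smooth_of_isNilpotent` — **smooth ⇒ infinitesimal lifting for local points**: for
  `f : Y → Spec K` SMOOTH, `R` a LOCAL ring, `π : R' → R` surjective with NILPOTENT kernel, every
  `K`-morphism `g : Spec R → Y` lifts to a `K`-morphism `g' : Spec R' → Y` (`Spec.map π ≫ g' = g`,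
  `g' ≫ f = s`) — [StacksProject, Tag 02H6] (smooth ⇒ formally smooth) tested on the one-point thickening
  `Spec R ↪ Spec R'`.  Road: `g = Spec.map φ ≫ Y.fromSpecStalk y` for the local homomorphism
  `φ = stalkClosedPointTo g : 𝒪_{Y,y} → R` (Mathlib); `𝒪_{Y,y}` is formally smooth over `K` (Mathlib
  `Scheme.Hom.smoothLocus_eq_top`: stalk maps of a smooth morphism are formally smooth, and
  `K → 𝒪_{Spec K, f y}` is a localisation); Mathlib `Algebra.FormallySmooth.liftOfSurjective` lifts `φ`.
  No affine chart, no locality of `R'`, no properness of `Y`;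
* `isLocalRing_stalkModPow`, `isNilpotent_ker_quotient_factor`, `isNilpotent_ker_stalkModPowTransitionHom`,
  `subsingleton_thickeningPt_left`, `thickKer_sq_eq_bot` — `𝒪_{T,t}/𝔪^{n+1}` is local, `Spec` of it has one
  point, `𝒪/𝔪^{n+2} → 𝒪/𝔪^{n+1}` (★ `stalkModPowTransitionHom`/`thickπ`) has nilpotent, indeed square-zero,
  kernel (★ `thickKer`);
* `exists_thickeningPtTransition_comp_eq` — for `Y → Spec K` smooth, every `K`-morphism
  `thickeningPt T t n → Y` (★ `Motives/TheoremOfCubeThickenings`) extends along the transition map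
  ★ `thickeningPtTransition T t n` (`Motives/ThickeningPtSections`) to `thickeningPt T t (n + 1) → Y`;
  `AbelianVariety.exists_thickeningPtTransition_comp_eq` — the same for `Y = B.X`, `B` an abelian variety
  (★ `AbelianVariety.smooth_hom`);
* `AlgHom.isScalarTower_toAlgebra`, `AlgHom.existsUnique_derivation_of_comp_eq`,
  `AlgHom.exists_lift_of_derivation` — THE TORSOR OF LIFTS, pure algebra: two `R₀`-algebra homomorphisms
  `φ', φ'' : A → B` with the same reduction modulo a square-zero ideal `I` differ by a UNIQUE `R₀`-derivation
  `δ : A → I` (`I` an `A`-module through `φ'`), `φ'' = φ' + δ`, and every derivation occurs (Mathlib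
  `derivationToSquareZeroOfLift` / `liftOfDerivationToSquareZero`, repackaged instance-free);
* `formallySmooth_appLE_top_comp`, `formallySmooth_sections_of_isAffineOpen` — for `Y → Spec K` smooth and
  `U ⊆ Y` an affine open, the scalar map `K → Γ(Y, U)` (`= Motives.SchemeOver.scalarRingHom Y U` of
  `Motives/AlgPointsProperProofs`, definitionally) is formally smooth;
* `existsUnique_fac_of_closedPoint_mem`, `existsUnique_fac_thickeningPt` — a morphism from the spectrum of a
  local ring (e.g. a `thickeningPt`-point) factors uniquely through any open containing the image of the
  closed point (Mathlib `IsOpenImmersion.lift`).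

Mathlib searched (pin): `AlgebraicGeometry.Smooth`, `Scheme.Hom.smoothLocus_eq_top`,
`Scheme.Hom.mem_smoothLocus`, `RingHom.FormallySmooth.comp`, `RingHom.formallySmooth_algebraMap`,
`Algebra.FormallySmooth.of_isLocalization`, `Algebra.FormallySmooth.liftOfSurjective`,
`Algebra.FormallySmooth.comp_liftOfSurjective`, `Scheme.stalkClosedPointTo`,
`Scheme.Spec_stalkClosedPointTo_fromSpecStalk`, `Scheme.SpecMap_stalkMap_fromSpecStalk`,
`Spec.fromSpecStalk_eq'`, `Spec.preimage`, `Spec.map_preimage`, `Spec.map_inj`,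
`StructureSheaf.IsLocalization.to_stalk`, `IsLocalRing.of_surjective'`, `derivationToSquareZeroOfLift`,
`liftOfDerivationToSquareZero`, `IsOpenImmersion.lift(_fac,_uniq)`, `Scheme.preimage_eq_top_of_closedPoint_mem`,
`PrimeSpectrum.comap_injective_of_surjective` (used); Mathlib has no scheme-level formal smoothness /
infinitesimal lifting statement (`AlgebraicGeometry/Morphisms/` has `Smooth`, `FormallyUnramified`, `Etale`).

## References

* D. Mumford, *Abelian Varieties*, Tata Institute Studies in Mathematics 5, Oxford University Press (1970):
  §13, proof of the Theorem, pp. 125–126. [MumfordAV1970]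
* The Stacks Project, Tag 02H6 (More on Morphisms, Lemma 37.11.7 «Infinitesimal lifting criterion»: a
  morphism locally of finite presentation is smooth iff formally smooth) and Tag 02H0 (Definition 37.11.1, in Section 02GZ «Formally smooth morphisms»).
  [StacksProject]
* A. Grothendieck, J. Dieudonné, *Éléments de géométrie algébrique* IV_4, Publ. Math. IHÉS 32 (1967):
  Déf. (17.1.1), Prop. (17.1.6), Thm. (17.5.1). [EGAIV4]
* U. Görtz, T. Wedhorn, *Algebraic Geometry II: Cohomology of Schemes*, Springer Spektrum (2023),
  doi:10.1007/978-3-658-43031-3: Lemma 24.72 (p. 409), proof, Step (I) (p. 410) (the local Artinian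
  quotients `A` of `𝒪_{S,s}` and the small extensions `A → A₀`). [GortzWedhorn2023]
-/

universe u

open CategoryTheory CategoryTheory.Limits AlgebraicGeometry

noncomputable section

namespace Literature.AlgebraicGeometry.Motives

/-! ### The generic lifting statement -/

section Generic

variable {K : Type u} [Field K]

/-- The structure map `K → 𝒪_{Spec K, p}` of a stalk of `Spec K` is formally smooth (it is a
localization map). [folklore] -/
private theorem formallySmooth_toStalk_field (p : PrimeSpectrum K) :
    (StructureSheaf.toStalk K p).hom.FormallySmooth := by
  have h : Algebra.FormallySmooth K ((Spec.structureSheaf K).presheaf.stalk p) :=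
    Algebra.FormallySmooth.of_isLocalization p.asIdeal.primeCompl
  exact RingHom.formallySmooth_algebraMap.mpr h

/-- **Smooth ⇒ infinitesimal lifting for local Artinian points.**  Let `f : Y → Spec K` be smooth,
`R` a local ring, `π : R' → R` a surjective ring homomorphism with nilpotent kernel, `s : Spec R' → Spec K`
and `g : Spec R → Y` a morphism with `g ≫ f = Spec.map π ≫ s` (a `K`-morphism for the `K`-structure
`Spec.map π ≫ s` of `Spec R`).  Then `g` lifts: there is `g' : Spec R' → Y` over `K` with
`Spec.map π ≫ g' = g`.  (Formal smoothness of `f`, tested on the nilpotent thickening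
`Spec R ↪ Spec R'` of a one-point source; proof through the formally smooth local ring `𝒪_{Y,g(𝔪)}`.)
[cite: StacksProject, Tag 02H6] [cite: MumfordAV1970, §13 (proof of the Thm. p. 125)] -/
theorem exists_lift_of_smooth_of_isNilpotent {Y : Scheme.{u}} (f : Y ⟶ Spec (.of K)) [Smooth f]
    {R R' : CommRingCat.{u}} [IsLocalRing R] (π : R' ⟶ R) (hπ : Function.Surjective π.hom)
    (hnil : IsNilpotent (RingHom.ker π.hom)) (s : Spec R' ⟶ Spec (.of K)) (g : Spec R ⟶ Y)
    (w : g ≫ f = Spec.map π ≫ s) :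
    ∃ g' : Spec R' ⟶ Y, Spec.map π ≫ g' = g ∧ g' ≫ f = s := by
  classical
  -- the closed point of `Spec R`, its image `y`, and the local homomorphism `φ : 𝒪_{Y,y} → R`
  set y : Y := g (IsLocalRing.closedPoint R) with hy
  let φ : Y.presheaf.stalk y ⟶ R := Scheme.stalkClosedPointTo g
  have hφ : Spec.map φ ≫ Y.fromSpecStalk y = g := Scheme.Spec_stalkClosedPointTo_fromSpecStalk g
  -- the `K`-structures: `σ' : K → R'` with `s = Spec.map σ'`, `ψ : K → 𝒪_{Y,y}`
  let σ' : CommRingCat.of K ⟶ R' := Spec.preimage s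
  have hσ' : Spec.map σ' = s := Spec.map_preimage s
  let τ : CommRingCat.of K ⟶ (Spec (.of K)).presheaf.stalk (f y) := StructureSheaf.toStalk K (f y)
  have hτ : (Spec (CommRingCat.of K)).fromSpecStalk (f y) = Spec.map τ := Spec.fromSpecStalk_eq' _ _
  let ψ : CommRingCat.of K ⟶ Y.presheaf.stalk y := τ ≫ f.stalkMap y
  -- `𝒪_{Y,y}` is formally smooth over `K`
  have hψ : ψ.hom.FormallySmooth := by
    have h1 : (f.stalkMap y).hom.FormallySmooth := by
      rw [← Scheme.Hom.mem_smoothLocus, Scheme.Hom.smoothLocus_eq_top]; trivial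
    exact (formallySmooth_toStalk_field (f y)).comp h1
  -- the compatibility `φ ∘ ψ = π ∘ σ'` read off `g ≫ f = Spec.map π ≫ s`
  have hcomp : ψ ≫ φ = σ' ≫ π := by
    rw [← Spec.map_inj]
    simp only [Spec.map_comp, Category.assoc, ψ]
    rw [← hτ, Scheme.SpecMap_stalkMap_fromSpecStalk, reassoc_of% hφ, hσ', w]
  -- algebra structures and the formally smooth lift
  letI algA : Algebra K (Y.presheaf.stalk y) := ψ.hom.toAlgebra
  letI algB : Algebra K R' := σ'.hom.toAlgebra
  letI algC : Algebra K R := (σ' ≫ π).hom.toAlgebra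
  haveI : Algebra.FormallySmooth K (Y.presheaf.stalk y) := hψ
  let gₐ : R' →ₐ[K] R := { π.hom with commutes' := fun _ => rfl }
  let fₐ : Y.presheaf.stalk y →ₐ[K] R :=
    { φ.hom with
      commutes' := fun k => by
        change φ.hom (ψ.hom k) = (σ' ≫ π).hom k
        rw [← CommRingCat.comp_apply, hcomp] }
  have hnil' : IsNilpotent (RingHom.ker (gₐ : R' →+* R)) := hnil
  let φ' : Y.presheaf.stalk y →ₐ[K] R' := Algebra.FormallySmooth.liftOfSurjective fₐ gₐ hπ hnil'
  have hφ' : gₐ.comp φ' = fₐ := Algebra.FormallySmooth.comp_liftOfSurjective fₐ gₐ hπ hnil'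
  refine ⟨Spec.map (CommRingCat.ofHom φ'.toRingHom) ≫ Y.fromSpecStalk y, ?_, ?_⟩
  · -- `Spec.map π ≫ g' = g`
    have e : CommRingCat.ofHom φ'.toRingHom ≫ π = φ := by
      ext x
      exact AlgHom.congr_fun hφ' x
    rw [← Spec.map_comp_assoc, e, hφ]
  · -- `g' ≫ f = s`
    have e : ψ ≫ CommRingCat.ofHom φ'.toRingHom = σ' := by
      ext k
      exact φ'.commutes k
    rw [Category.assoc, ← Scheme.SpecMap_stalkMap_fromSpecStalk, hτ, ← Spec.map_comp_assoc,
      ← Spec.map_comp]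
    change Spec.map (ψ ≫ CommRingCat.ofHom φ'.toRingHom) = s
    rw [e, hσ']

end Generic

/-! ### Packaging for the thickenings `thickeningPt T t n = Spec(𝒪_{T,t}/𝔪^{n+1})` -/

section Thickening

variable {K : Type u} [Field K] (T : SchemeOver K) (t : T.left)

/-- `𝒪_{T,t}/𝔪_t^{n+1}` is a local ring (a theorem, not an instance: use `haveI`) — the local Artinian
quotients `A` of `𝒪_{S,s}` of [GortzWedhorn2023] Lemma 24.72. [cite: GortzWedhorn2023, Lemma 24.72 (p. 409), proof, Step (I) (p. 410)] -/
theorem isLocalRing_stalkModPow (n : ℕ) : IsLocalRing (stalkModPow T t n) :=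
  IsLocalRing.of_surjective' (Ideal.Quotient.mk _) Ideal.Quotient.mk_surjective

/-- For ideals `S ≤ T` with `T ^ k ≤ S`, the kernel of `A ⧸ S → A ⧸ T` (namely `T/S`) is nilpotent.
[folklore] -/
private theorem isNilpotent_ker_quotient_factor {A : Type*} [CommRing A] {S T : Ideal A} (H : S ≤ T)
    {k : ℕ} (hk : T ^ k ≤ S) : IsNilpotent (RingHom.ker (Ideal.Quotient.factor H)) := by
  have hker : RingHom.ker (Ideal.Quotient.factor H) = T.map (Ideal.Quotient.mk S) := by
    ext x
    obtain ⟨r, rfl⟩ := Ideal.Quotient.mk_surjective x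
    rw [RingHom.mem_ker, Ideal.Quotient.factor_mk, Ideal.Quotient.eq_zero_iff_mem,
      Ideal.mem_map_iff_of_surjective _ Ideal.Quotient.mk_surjective]
    constructor
    · exact fun h => ⟨r, h, rfl⟩
    · rintro ⟨r', hr', e⟩
      rw [Ideal.Quotient.eq] at e
      have : r = r' - (r' - r) := by ring
      rw [this]
      exact sub_mem hr' (H e)
  refine ⟨k, ?_⟩
  rw [hker, ← Ideal.map_pow, Ideal.zero_eq_bot, eq_bot_iff, Ideal.map_le_iff_le_comap]
  intro x hx
  rw [Ideal.mem_comap, Ideal.mem_bot, Ideal.Quotient.eq_zero_iff_mem]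
  exact hk hx

/-- The kernel of `𝒪/𝔪^{n+2} → 𝒪/𝔪^{n+1}` (namely `𝔪^{n+1}/𝔪^{n+2}`, square-zero) is nilpotent — the
small extensions `A → A₀` with kernel killed by `𝔪` of [GortzWedhorn2023] Lemma 24.72, Step (I).
[cite: GortzWedhorn2023, Lemma 24.72 (p. 409), proof, Step (I) (p. 410)] -/
theorem isNilpotent_ker_stalkModPowTransitionHom (n : ℕ) :
    IsNilpotent (RingHom.ker (stalkModPowTransitionHom T t n)) :=
  isNilpotent_ker_quotient_factor (A := T.left.presheaf.stalk t)
    (Ideal.pow_le_pow_right (Nat.le_succ _)) (k := 2)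
    (by rw [← pow_mul]; exact Ideal.pow_le_pow_right (by omega))

/-- **Lifting along the thickening tower.**  For `Y → Spec K` smooth, every `K`-morphism
`g : thickeningPt T t n → Y` (i.e. `Spec(𝒪_{T,t}/𝔪^{n+1}) → Y`) extends along the transition map
`thickeningPtTransition T t n : thickeningPt T t n ↪ thickeningPt T t (n + 1)` to a `K`-morphism
`g' : thickeningPt T t (n + 1) → Y`.  (Mumford's «since `X̂` is non-singular, `g_R` lifts to `R'`» for
the small extension `𝒪/𝔪^{n+2} → 𝒪/𝔪^{n+1}`.)
[cite: MumfordAV1970, §13 (proof of the Thm. p. 125)] [cite: StacksProject, Tag 02H6] -/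
theorem exists_thickeningPtTransition_comp_eq (Y : SchemeOver K) [Smooth Y.hom] (n : ℕ)
    (g : thickeningPt T t n ⟶ Y) :
    ∃ g' : thickeningPt T t (n + 1) ⟶ Y, thickeningPtTransition T t n ≫ g' = g := by
  haveI := isLocalRing_stalkModPow T t n
  have w : g.left ≫ Y.hom = Spec.map (stalkModPowTransition T t n) ≫ (thickeningPt T t (n + 1)).hom := by
    rw [Over.w g]
    exact (Over.w (thickeningPtTransition T t n)).symm
  obtain ⟨g', h1, h2⟩ := exists_lift_of_smooth_of_isNilpotent Y.hom (stalkModPowTransition T t n)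
    (stalkModPowTransitionHom_surjective T t n) (isNilpotent_ker_stalkModPowTransitionHom T t n)
    (thickeningPt T t (n + 1)).hom g.left w
  refine ⟨Over.homMk g' h2, ?_⟩
  ext : 1
  exact h1

/-- **Abelian-variety form of the consumer head**: for an abelian variety `B` over `K` (smooth over
`K`, ★ `AbelianVariety.smooth_hom`), every `K`-morphism `thickeningPt T t n → B.X` extends to
`thickeningPt T t (n + 1) → B.X` along the transition map (Mumford §13: the `Â`-coordinate `g_n` of an
infinitesimal graph point lifts to some `g_{n+1}`; the torsor of all lifts is then corrected by the
Kodaira–Spencer class).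
[cite: MumfordAV1970, §13 (proof of the Thm. p. 125)] -/
theorem AbelianVariety.exists_thickeningPtTransition_comp_eq (B : AbelianVariety K) (n : ℕ)
    (g : thickeningPt T t n ⟶ B.X) :
    ∃ g' : thickeningPt T t (n + 1) ⟶ B.X, thickeningPtTransition T t n ≫ g' = g :=
  haveI := B.smooth_hom
  Literature.AlgebraicGeometry.Motives.exists_thickeningPtTransition_comp_eq T t B.X n g

/-- `Spec(𝒪_{T,t}/𝔪^{n+1})` has exactly one point (the infinitesimal neighbourhoods
`Spec(𝒪_{S,s}/𝔪_s^{n+1})` of [GortzWedhorn2023] Thm. 24.42 / Lemma 24.72 are one-point schemes).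
[cite: GortzWedhorn2023, Lemma 24.72 (p. 409), proof, Step (I) (p. 410)] -/
theorem subsingleton_thickeningPt_left (n : ℕ) : Subsingleton (thickeningPt T t n).left := by
  refine ⟨fun s s' => ?_⟩
  apply PrimeSpectrum.comap_injective_of_surjective _ Ideal.Quotient.mk_surjective
  rw [comap_mk_pow_maximalIdeal_eq_closedPoint, comap_mk_pow_maximalIdeal_eq_closedPoint]

/-- The kernel `I_n = 𝔪^{n+1}/𝔪^{n+2}` of `π_n : 𝒪/𝔪^{n+2} → 𝒪/𝔪^{n+1}` (★ `thickKer`) is square-zero —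
so the torsor lemmas `AlgHom.existsUnique_derivation_of_comp_eq` / `AlgHom.exists_lift_of_derivation`
below apply to `I := thickKer T x n` ([GortzWedhorn2023] Lemma 24.72 Step (I): `𝔪 · I = 0`).
[cite: GortzWedhorn2023, Lemma 24.72 (p. 409), proof, Step (I) (p. 410)] -/
theorem thickKer_sq_eq_bot {B : T.left.Opens} (x : B) (n : ℕ) : thickKer T x n ^ 2 = ⊥ := by
  rw [thickKer, ← Ideal.map_pow, eq_bot_iff, Ideal.map_le_iff_le_comap]
  intro r hr
  rw [Ideal.mem_comap, Ideal.mem_bot, Ideal.Quotient.eq_zero_iff_mem]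
  rw [← pow_mul] at hr
  exact Ideal.pow_le_pow_right (by omega) hr

end Thickening

/-! ### The torsor of lifts along a square-zero surjection: pure algebra -/

section LiftTorsor

variable {R₀ A B : Type*} [CommRing R₀] [CommRing A] [CommRing B] [Algebra R₀ A] [Algebra R₀ B]

/-- For an `R₀`-algebra homomorphism `φ : A → B`, the `A`-algebra structure `φ.toRingHom.toAlgebra`
on `B` is compatible with the `R₀`-structures. [folklore] -/
private theorem AlgHom.isScalarTower_toAlgebra (φ : A →ₐ[R₀] B) :
    letI := φ.toRingHom.toAlgebra; IsScalarTower R₀ A B :=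
  letI := φ.toRingHom.toAlgebra
  IsScalarTower.of_algebraMap_eq fun r => (φ.commutes r).symm

/-- **Lifts along a square-zero surjection form a torsor under derivations (uniqueness half).**
Let `I ⊆ B` be an ideal with `I² = 0` and `φ', φ'' : A →ₐ[R₀] B` two homomorphisms with the same
reduction modulo `I`.  Then, `I` being an `A`-module through `φ'`, there is a UNIQUE
`R₀`-derivation `δ : A → I` with `φ'' = φ' + δ`.  (Mumford §13: «the set of all liftings `g'` is a
principal homogeneous space over `Der`»; Mathlib `derivationToSquareZeroOfLift`, repackaged.)
[cite: MumfordAV1970, §13 (proof of the Thm. p. 126)] [cite: StacksProject, Tag 02H6] -/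
theorem AlgHom.existsUnique_derivation_of_comp_eq (I : Ideal B) (hI : I ^ 2 = ⊥)
    (φ' φ'' : A →ₐ[R₀] B)
    (e : (Ideal.Quotient.mkₐ R₀ I).comp φ'' = (Ideal.Quotient.mkₐ R₀ I).comp φ') :
    letI := φ'.toRingHom.toAlgebra
    ∃! δ : Derivation R₀ A I, ∀ a, φ'' a = φ' a + (δ a : B) := by
  letI := φ'.toRingHom.toAlgebra
  haveI := AlgHom.isScalarTower_toAlgebra φ'
  have e' : (Ideal.Quotient.mkₐ R₀ I).comp φ'' = IsScalarTower.toAlgHom R₀ A (B ⧸ I) := by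
    rw [e]; ext a; rfl
  refine ⟨derivationToSquareZeroOfLift I hI φ'' e', fun a => ?_, fun δ hδ => ?_⟩
  · rw [derivationToSquareZeroOfLift_apply]
    change φ'' a = φ' a + (φ'' a - φ' a)
    ring
  · ext a
    rw [derivationToSquareZeroOfLift_apply]
    change (δ a : B) = φ'' a - φ' a
    rw [hδ a]
    ring

/-- **Lifts along a square-zero surjection form a torsor under derivations (existence half).**
With `I² = 0` and `φ' : A →ₐ[R₀] B`, every `R₀`-derivation `δ : A → I` (`I` an `A`-module
through `φ'`) gives a homomorphism `φ'' = φ' + δ : A →ₐ[R₀] B` with the same reduction modulo `I`.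
(Mathlib `liftOfDerivationToSquareZero`, repackaged.)
[cite: MumfordAV1970, §13 (proof of the Thm. p. 126)] [cite: StacksProject, Tag 02H6] -/
theorem AlgHom.exists_lift_of_derivation (I : Ideal B) (hI : I ^ 2 = ⊥) (φ' : A →ₐ[R₀] B) :
    letI := φ'.toRingHom.toAlgebra
    ∀ δ : Derivation R₀ A I, ∃ φ'' : A →ₐ[R₀] B,
      (Ideal.Quotient.mkₐ R₀ I).comp φ'' = (Ideal.Quotient.mkₐ R₀ I).comp φ' ∧
        ∀ a, φ'' a = φ' a + (δ a : B) := by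
  letI := φ'.toRingHom.toAlgebra
  haveI := AlgHom.isScalarTower_toAlgebra φ'
  intro δ
  refine ⟨liftOfDerivationToSquareZero I hI δ, ?_, fun a => ?_⟩
  · ext a
    change Ideal.Quotient.mk I (liftOfDerivationToSquareZero I hI δ a) = Ideal.Quotient.mk I (φ' a)
    rw [liftOfDerivationToSquareZero_mk_apply]
    rfl
  · rw [liftOfDerivationToSquareZero_apply, add_comm]
    rfl

end LiftTorsor

/-! ### Affine opens of a smooth `K`-scheme have formally smooth coordinate rings -/

section AffineChart

variable {K : Type u} [Field K]

/-- **`K → Γ(Y, U)` is formally smooth for `U` an affine open of a smooth `K`-scheme `Y`.**  The ring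
homomorphism here is `c ↦ Y.hom.appLE ⊤ U le_top ((ΓSpecIso K).inv c)`, which is DEFINITIONALLY the
tree's `Motives.SchemeOver.scalarRingHom Y U` (`Motives/AlgPointsProperProofs`) and the restriction of
`Modules.…scalarRingHomTop` — so chart homomorphisms `Γ(Y, U) →ₐ[K] R` lift along surjections with
nilpotent kernel at ring level (Mathlib `Algebra.FormallySmooth.liftOfSurjective`).
[cite: StacksProject, Tag 02H6] [cite: MumfordAV1970, §13 (proof of the Thm. p. 125)] -/
theorem formallySmooth_appLE_top_comp (Y : SchemeOver K) [Smooth Y.hom] (U : Y.left.Opens)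
    (hU : IsAffineOpen U) :
    ((Y.hom.appLE ⊤ U le_top).hom.comp (Scheme.ΓSpecIso (.of K)).inv.hom).FormallySmooth := by
  have h1 : (Y.hom.appLE ⊤ U le_top).hom.FormallySmooth :=
    (Y.hom.smooth_appLE (isAffineOpen_top (Spec (.of K))) hU le_top).formallySmooth
  have h2 : (Scheme.ΓSpecIso (CommRingCat.of K)).inv.hom.FormallySmooth :=
    RingHom.FormallySmooth.of_bijective (ConcreteCategory.bijective_of_isIso _)
  exact h2.comp h1

/-- The same with the `K`-algebra structure installed: `Γ(Y, U)` is a formally smooth `K`-algebra for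
the scalar map `K → Γ(Y, U)`. [cite: StacksProject, Tag 02H6] -/
theorem formallySmooth_sections_of_isAffineOpen (Y : SchemeOver K) [Smooth Y.hom] (U : Y.left.Opens)
    (hU : IsAffineOpen U) :
    letI := ((Y.hom.appLE ⊤ U le_top).hom.comp (Scheme.ΓSpecIso (.of K)).inv.hom).toAlgebra
    Algebra.FormallySmooth K Γ(Y.left, U) :=
  formallySmooth_appLE_top_comp Y U hU

end AffineChart

/-! ### Morphisms from local (one-point) spectra factor through opens -/

section Factor

/-- A morphism `f : Spec R → X` from the spectrum of a LOCAL ring factors uniquely through any open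
`U ⊆ X` containing the image of the closed point (every point of `Spec R` generalises the closed
point and `U` is stable under generalisation; Mathlib `Scheme.preimage_eq_top_of_closedPoint_mem` +
`IsOpenImmersion.lift`) — [MumfordAV1970] §13 p. 125: the `R`-valued points through a point, `R` local
Artinian, live in an affine neighbourhood. [cite: MumfordAV1970, §13 (proof of the Thm. p. 125)] -/
theorem existsUnique_fac_of_closedPoint_mem {X : Scheme.{u}} {R : CommRingCat.{u}} [IsLocalRing R]
    (f : Spec R ⟶ X) (U : X.Opens) (h : f (IsLocalRing.closedPoint R) ∈ U) :
    ∃! f₀ : Spec R ⟶ (U : Scheme.{u}), f₀ ≫ U.ι = f := by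
  have hr : Set.range f ⊆ Set.range U.ι := by
    rw [Scheme.Opens.range_ι]
    rintro _ ⟨s, rfl⟩
    have hs : s ∈ f ⁻¹ᵁ U := by
      rw [Scheme.preimage_eq_top_of_closedPoint_mem f h]; trivial
    exact hs
  refine ⟨IsOpenImmersion.lift U.ι f hr, IsOpenImmersion.lift_fac U.ι f hr, fun f₀ hf₀ => ?_⟩
  exact IsOpenImmersion.lift_uniq U.ι f hr f₀ hf₀

variable {K : Type u} [Field K] (T : SchemeOver K) (t : T.left)

/-- A `thickeningPt`-point `g : Spec(𝒪_{T,t}/𝔪^{n+1}) → Y` factors uniquely through any open `U ⊆ Y`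
containing its (one-point) image — the «chart» through which one reads `g` as a homomorphism
`Γ(Y, U) → 𝒪_{T,t}/𝔪^{n+1}`. [cite: MumfordAV1970, §13 (proof of the Thm. p. 125)] -/
theorem existsUnique_fac_thickeningPt {Y : SchemeOver K} (n : ℕ) (g : thickeningPt T t n ⟶ Y)
    (U : Y.left.Opens) (s : (thickeningPt T t n).left) (h : g.left s ∈ U) :
    ∃! g₀ : (thickeningPt T t n).left ⟶ (U : Scheme.{u}), g₀ ≫ U.ι = g.left := by
  have hr : Set.range g.left ⊆ Set.range U.ι := by
    rw [Scheme.Opens.range_ι]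
    rintro _ ⟨s', rfl⟩
    rw [@Subsingleton.elim _ (subsingleton_thickeningPt_left T t n) s' s]
    exact h
  exact ⟨IsOpenImmersion.lift U.ι g.left hr, IsOpenImmersion.lift_fac U.ι g.left hr,
    fun g₀ hg₀ => IsOpenImmersion.lift_uniq U.ι g.left hr g₀ hg₀⟩

end Factor

end Literature.AlgebraicGeometry.Motives

end
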